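import Summits.QuantumAdvantage.QuantumAdvantage.Theorems.CubicForrelationNearExactIsExactTwelveOddWeightR4
import Summits.QuantumAdvantage.QuantumAdvantage.Theorems.CubicForrelationNearExactIsExactTwelveTypeOPairParity
import Summits.QuantumAdvantage.QuantumAdvantage.Theorems.CubicForrelationNearExactIsExactTwelveTypeOPairResidue

/-!
# Crux `CubicForrelation.NearExactIsExact` (stmt-QuantumAdvantage-14043) — n = 12, WEIGHT OF A TYPE-O CUBIC, VIII: THEOREM W and the
  "`κ₁` of type O" branch of the wild (O,O) window analysis

Certificate seat `b2b-cforr-cert` (gen 32).  HONEST FRAMING: a kernel-checked finite-slice theorem about cubic Boolean functions on 12 bits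
(standard axioms), and its consequence for the bookkeeping of the open acceptance window `(57/64, 29/32)` of the 12-bit cubic-Forrelation slice:
it EMPTIES one of the two branches of `topp_parity_dichotomy` in the light regime.  It is NOT summit progress and gives no value of `θ₁₂`.

* `tow_weight_ge_1280` (THEOREM W): a cubic `κ : 𝔽₂¹² → 𝔽₂` with `wt κ ≡ 8 (mod 16)` has `wt κ ≥ 1280`.
  Proof: if `wt κ < 1280` some derivative `D_aκ` (`a ≠ 0`) is a quadratic with `< 1792` ones (`tow_light_derivative`), hence with `0`, `1024`
  or `1536` ones (`tow_quadratic_light`); `0` is impossible for a type-O function (`tow_no_period`), `1024` forces `wt ≥ 1304` (`tow_weight_R2`)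
  and `1536` forces `wt ≥ 1304` (`tow_weight_R4`).
* `topw_typeO_branch_weight` / `topw_typeO_branch_false` / `topw_level_of_light`: in the two-sided type-O setting of …TwelveTypeOPair*, the branch
  "`v̂₁ ∈ 4·odd`" forces `wt κ₁ ≡ 8 (mod 16)` (`topq_card_typeO_branch`), hence `wt κ₁ ≥ 1280`; so whenever `wt κ₁ ≤ 1272` the LEVEL branch
  `8 ∣ v̂₁` holds.

References: T. Kasami, N. Tokura (1970); F. J. MacWilliams, N. J. A. Sloane (1977) Ch. 15.  Axioms: the standard three.
-/

set_option linter.dupNamespace false -- D-0017: single-problem summit ⇒ `QuantumAdvantage.QuantumAdvantage` by design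

noncomputable section

namespace Summit.QuantumAdvantage.QuantumAdvantage.Theorems.CubicForrelation.NearExactIsExact

open Finset
open Literature.Computability.QuantumComplexity
open Literature.Computability.QuantumComplexity.BuzetChailloux (bxor zeroVec bxor_bxor_cancel_left bxor_zeroVec zeroVec_bxor bxor_comm
  bxor_self twist_bxor_right twist_zeroVec_right sum_twist_left bxor_eq_zeroVec_iff)
open Literature.Computability.QuantumComplexity.DerivativeWalsh (W twist_bxor_left)

/-- **THEOREM W.**  A cubic Boolean function on 12 bits whose weight is `≡ 8 (mod 16)` has weight at least `1280`.
Finite-slice statement, NOT summit progress. [this work] -/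
theorem tow_weight_ge_1280 (κ : (Fin (6 + 6) → Bool) → Bool) (hκ : IsDegLeFun 3 κ)
    (hw : #(univ.filter fun x : Fin (6 + 6) → Bool => κ x = true) % 16 = 8) :
    1280 ≤ #(univ.filter fun x : Fin (6 + 6) → Bool => κ x = true) := by
  by_contra hlt
  rw [not_le] at hlt
  have hpos : 0 < #(univ.filter fun x : Fin (6 + 6) → Bool => κ x = true) := by omega
  obtain ⟨a, ha, hDlt⟩ := tow_light_derivative κ hpos hlt
  have hq2 : IsDegLeFun 2 (fun x => κ x ^^ κ (bxor x a)) := stub_derivDegree (6 + 6) 2 κ a hκ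
  rcases tow_quadratic_light _ hq2 hDlt with h0 | h1 | h2
  · obtain ⟨u, hu, hodd⟩ := tow_typeO_of_weight κ hκ hw
    exact tow_no_period κ u hu hodd a ha h0
  · have := tow_weight_R2 κ hκ hw a ha h1
    omega
  · have := tow_weight_R4 κ hκ hw a ha h2
    omega

/-- **The type-O branch is heavy.**  In the two-sided type-O setting (…TwelveTypeOPair*), if `v̂₁ ∈ 4·odd` everywhere then `wt κ₁ ≥ 1280`.
Window bookkeeping, NOT summit progress. [this work] -/
theorem topw_typeO_branch_weight (F₁ F₂ : (Fin (6 + 6) → Bool) → Bool) (u₁ u₂ v₁ v₂ : (Fin (6 + 6) → Bool) → ℤ)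
    (hu₁ : ∀ x, W (fun y => signOf (F₁ y)) x = (2 : ℝ) ^ 4 * (u₁ x : ℝ))
    (hu₂ : ∀ y, W (fun x => signOf (F₂ x)) y = (2 : ℝ) ^ 4 * (u₂ y : ℝ))
    (κ₁ κ₂ : (Fin (6 + 6) → Bool) → Bool) (hκ₁ : IsDegLeFun 3 κ₁) (b₁ b₂ : Bool) (c₁ c₂ : Fin (6 + 6) → Bool)
    (h₁ : ∀ x, (((u₁ x - 4 * sZ (F₂ x) : ℤ)) : ℝ) = signOf b₁ * twist c₁ x * (1 - 4 * (if κ₁ x = true then 1 else 0)) + 8 * (v₁ x : ℝ))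
    (h₂ : ∀ y, (((u₂ y - 4 * sZ (F₁ y) : ℤ)) : ℝ) = signOf b₂ * twist c₂ y * (1 - 4 * (if κ₂ y = true then 1 else 0)) + 8 * (v₂ y : ℝ))
    (hO : ∀ y, ∃ k : ℤ, Odd k ∧ ∑ x, (v₁ x : ℝ) * twist x y = 4 * (k : ℝ)) :
    1280 ≤ #(univ.filter fun x : Fin (6 + 6) → Bool => κ₁ x = true) := by
  obtain ⟨k, hk, hkv⟩ := hO c₁
  exact tow_weight_ge_1280 κ₁ hκ₁ (topq_card_typeO_branch F₁ F₂ u₁ u₂ v₁ v₂ hu₁ hu₂ κ₁ κ₂ b₁ b₂ c₁ c₂ h₁ h₂ k hk hkv)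

/-- **The type-O branch is empty in the light regime** `wt κ₁ ≤ 1272`.  Window bookkeeping, NOT summit progress. [this work] -/
theorem topw_typeO_branch_false (F₁ F₂ : (Fin (6 + 6) → Bool) → Bool) (u₁ u₂ v₁ v₂ : (Fin (6 + 6) → Bool) → ℤ)
    (hu₁ : ∀ x, W (fun y => signOf (F₁ y)) x = (2 : ℝ) ^ 4 * (u₁ x : ℝ))
    (hu₂ : ∀ y, W (fun x => signOf (F₂ x)) y = (2 : ℝ) ^ 4 * (u₂ y : ℝ))
    (κ₁ κ₂ : (Fin (6 + 6) → Bool) → Bool) (hκ₁ : IsDegLeFun 3 κ₁) (b₁ b₂ : Bool) (c₁ c₂ : Fin (6 + 6) → Bool)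
    (h₁ : ∀ x, (((u₁ x - 4 * sZ (F₂ x) : ℤ)) : ℝ) = signOf b₁ * twist c₁ x * (1 - 4 * (if κ₁ x = true then 1 else 0)) + 8 * (v₁ x : ℝ))
    (h₂ : ∀ y, (((u₂ y - 4 * sZ (F₁ y) : ℤ)) : ℝ) = signOf b₂ * twist c₂ y * (1 - 4 * (if κ₂ y = true then 1 else 0)) + 8 * (v₂ y : ℝ))
    (hO : ∀ y, ∃ k : ℤ, Odd k ∧ ∑ x, (v₁ x : ℝ) * twist x y = 4 * (k : ℝ))
    (hle : #(univ.filter fun x : Fin (6 + 6) → Bool => κ₁ x = true) ≤ 1272) : False := by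
  have := topw_typeO_branch_weight F₁ F₂ u₁ u₂ v₁ v₂ hu₁ hu₂ κ₁ κ₂ hκ₁ b₁ b₂ c₁ c₂ h₁ h₂ hO
  omega

/-- **Light ⇒ LEVEL.**  In the two-sided type-O setting with `wt κ₁ ≤ 1272`, the twisted transform `v̂₁` is divisible by `8` everywhere
(the other branch of `topp_parity_dichotomy` being empty).  Window bookkeeping, NOT summit progress. [this work] -/
theorem topw_level_of_light (F₁ F₂ : (Fin (6 + 6) → Bool) → Bool) (u₁ u₂ v₁ v₂ : (Fin (6 + 6) → Bool) → ℤ)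
    (hu₁ : ∀ x, W (fun y => signOf (F₁ y)) x = (2 : ℝ) ^ 4 * (u₁ x : ℝ))
    (hu₂ : ∀ y, W (fun x => signOf (F₂ x)) y = (2 : ℝ) ^ 4 * (u₂ y : ℝ))
    (κ₁ κ₂ : (Fin (6 + 6) → Bool) → Bool) (hκ₁ : IsDegLeFun 3 κ₁) (b₁ b₂ : Bool) (c₁ c₂ : Fin (6 + 6) → Bool)
    (h₁ : ∀ x, (((u₁ x - 4 * sZ (F₂ x) : ℤ)) : ℝ) = signOf b₁ * twist c₁ x * (1 - 4 * (if κ₁ x = true then 1 else 0)) + 8 * (v₁ x : ℝ))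
    (h₂ : ∀ y, (((u₂ y - 4 * sZ (F₁ y) : ℤ)) : ℝ) = signOf b₂ * twist c₂ y * (1 - 4 * (if κ₂ y = true then 1 else 0)) + 8 * (v₂ y : ℝ))
    (hle : #(univ.filter fun x : Fin (6 + 6) → Bool => κ₁ x = true) ≤ 1272) :
    ∀ y, ∃ k : ℤ, ∑ x, (v₁ x : ℝ) * twist x y = 8 * (k : ℝ) := by
  rcases topp_parity_dichotomy F₁ F₂ u₁ u₂ v₁ v₂ hu₁ hu₂ κ₁ κ₂ hκ₁ b₁ b₂ c₁ c₂ h₁ h₂ with hO | hL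
  · exact (topw_typeO_branch_false F₁ F₂ u₁ u₂ v₁ v₂ hu₁ hu₂ κ₁ κ₂ hκ₁ b₁ b₂ c₁ c₂ h₁ h₂ hO hle).elim
  · exact hL

end Summit.QuantumAdvantage.QuantumAdvantage.Theorems.CubicForrelation.NearExactIsExact

end
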